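import Mathlib
import HarnessLib

/-!
# Route `KLProgramme` — crux K3 ENGINE (stmt-…-20437) stub (b) conj. 2 «(c-D)² FAMILY TELESCOPE», brick (D3): the RATE ARITHMETIC of the
# family-increment pair — the space and time rate inequalities of `…SectorSlicePairMoment.slicePairWt_charSum_l1_le` (FULL band) SOLVED in the two-scale class
# «multiplier = increment (relative jets polynomial in `x = 4^m`) × plain; band at the flow frame `K_m` (jets `b₁, b₂+b₂′x, b₃+b₃′x`)»

Cell `gate-hubbard-kl`, seat hubbard-kl-k3c3-p2 (g10); (R68c); design F1-DESIGN.md §8.  Pure real algebra, the twin of `…SectorSliceIncrRates` for the OTHER factor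
order: there the band was the increment and the multiplier plain; here the multiplier `Mf = Gs^Δ/A` is the (normalised) increment pair, its RELATIVE jets
`a_k ≤ η^k·R_k(x)` grow like `x^k` (`R₁ = r₁₀+r₁₁x`, `R₂ = r₂₀+r₂₁x+r₂₂x²`, `R₃ = r₃₀+…+r₃₃x³`, from `…FatMultiplierIncrementPairSpace` divided by `𝔅₀`), and the band is
the FULL slice symbol at the depth-`x` frame `K_m` (jets `K₁ᵇ ≤ b`, `K₂ᵇ ≤ b₂ + b₂′x`, `K₃ᵇ ≤ b₃ + b₃′x`, and the LATTICE-RESOLUTION hypothesis `K₂ᵇη ≤ b` —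
an `L`-threshold: the lattice step resolves the frame's curvature at depth `x` — which makes the composite slots `K₁ᵇη + jK₂ᵇη² ≤ (j+1)bη`).  With the rate `s = ρ/x`:

* `cubic_le_of_thresholds` / `quadratic_le_of_thresholds` — `C₀ + C₁x + C₂x² + C₃x³ ≤ K·x³/ρ³` from `4C_iρ³ ≤ K·x^{3−i}` (`x ≥ 1`), and the quadratic twin;
* **`famIncr_rate_three_le`** — the ORDER-THREE space inequality (first slot `t`: `t = K₁ᵇη` on the axes / normal, `t = τ` along the sector), in the form
  `LHS ≤ (4c/Λ)·(2η/(π(ρ/x)))³` (the caller multiplies by `(1/c)²` and converts `2η/(πs)` to `4|u|/(sL)` with `norm_toLp_latticeStep`);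
* **`famIncr_rate_two_le`** — the ORDER-TWO (anisotropic, along the sector) inequality, rate `ρ₃/x`;
* **`famIncr_rate_time_le`** — the TIME inequality (x-free: a level condition).

Everything is proved; no definitions, no sorry.  Nothing asserts superconductivity. [cite: BenfattoGiulianiMastropietro2006, §2.8 (2.81), §3 (3.2)–(3.8)]
-/

noncomputable section

namespace Summit.HubbardSuperconductivity.HubbardSuperconductivity.Theorems.TorusFourierL2

set_option linter.dupNamespace false -- summit = problem name (single-conjunct summit), D-0017

open scoped Real

/-! ### §1 The cubic threshold split -/

/-- **Cubic below `K x³/ρ³` from four thresholds**: `0 ≤ C_i`, `1 ≤ x`, `0 < ρ`, `4C₃ρ³ ≤ K`, `4C₂ρ³ ≤ Kx`, `4C₁ρ³ ≤ Kx²`, `4C₀ρ³ ≤ Kx³` ⇒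
`C₀ + C₁x + C₂x² + C₃x³ ≤ K·x³/ρ³`. [cite: BenfattoGiulianiMastropietro2006, §3 (3.2)] -/
theorem cubic_le_of_thresholds {C₀ C₁ C₂ C₃ K x ρ : ℝ} (hx : 1 ≤ x) (hρ : 0 < ρ)
    (h₃ : 4 * C₃ * ρ ^ 3 ≤ K) (h₂ : 4 * C₂ * ρ ^ 3 ≤ K * x) (h₁ : 4 * C₁ * ρ ^ 3 ≤ K * x ^ 2) (h₀ : 4 * C₀ * ρ ^ 3 ≤ K * x ^ 3) :
    C₀ + C₁ * x + C₂ * x ^ 2 + C₃ * x ^ 3 ≤ K * x ^ 3 / ρ ^ 3 := by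
  have hρ3 : 0 < ρ ^ 3 := by positivity
  have hx0 : 0 ≤ x := le_trans zero_le_one hx
  rw [le_div_iff₀ hρ3]
  have e3 : C₃ * x ^ 3 * ρ ^ 3 ≤ K / 4 * x ^ 3 := by nlinarith [mul_le_mul_of_nonneg_left h₃ (pow_nonneg hx0 3)]
  have e2 : C₂ * x ^ 2 * ρ ^ 3 ≤ K / 4 * x ^ 3 := by nlinarith [mul_le_mul_of_nonneg_left h₂ (pow_nonneg hx0 2)]
  have e1 : C₁ * x * ρ ^ 3 ≤ K / 4 * x ^ 3 := by nlinarith [mul_le_mul_of_nonneg_left h₁ hx0]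
  have e0 : C₀ * ρ ^ 3 ≤ K / 4 * x ^ 3 := by nlinarith [h₀]
  nlinarith [e0, e1, e2, e3]

/-- **Quadratic below `K x²/ρ²` from three thresholds**: `1 ≤ x`, `0 < ρ`, `3C₂ρ² ≤ K`, `3C₁ρ² ≤ Kx`, `3C₀ρ² ≤ Kx²` ⇒ `C₀ + C₁x + C₂x² ≤ K·x²/ρ²`.
[cite: BenfattoGiulianiMastropietro2006, §3 (3.2)] -/
theorem quadratic_le_of_thresholds {C₀ C₁ C₂ K x ρ : ℝ} (hx : 1 ≤ x) (hρ : 0 < ρ)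
    (h₂ : 3 * C₂ * ρ ^ 2 ≤ K) (h₁ : 3 * C₁ * ρ ^ 2 ≤ K * x) (h₀ : 3 * C₀ * ρ ^ 2 ≤ K * x ^ 2) :
    C₀ + C₁ * x + C₂ * x ^ 2 ≤ K * x ^ 2 / ρ ^ 2 := by
  have hρ2 : 0 < ρ ^ 2 := by positivity
  have hx0 : 0 ≤ x := le_trans zero_le_one hx
  rw [le_div_iff₀ hρ2]
  have e2 : C₂ * x ^ 2 * ρ ^ 2 ≤ K / 3 * x ^ 2 := by nlinarith [mul_le_mul_of_nonneg_left h₂ (pow_nonneg hx0 2)]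
  have e1 : C₁ * x * ρ ^ 2 ≤ K / 3 * x ^ 2 := by nlinarith [mul_le_mul_of_nonneg_left h₁ hx0]
  have e0 : C₀ * ρ ^ 2 ≤ K / 3 * x ^ 2 := by nlinarith [h₀]
  nlinarith [e0, e1, e2]

/-! ### §2 Order three in the family-increment class -/

set_option maxHeartbeats 800000 in
/-- **Order-three space rate inequality of the family-increment pair, solved.**  The Leibniz left side of `slicePairWt_charSum_l1_le` (without its `(βL²)⁻²`
prefactor) in a space direction with first band slot `t` (`t = K₁ᵇη` on the axes / normal, `t = τ` along the sector), band jets `K₂ ≤ b₂ + b₂′x`, `K₃ ≤ b₃ + b₃′x`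
(depth-`x` frame), the lattice-resolution hypotheses `t ≤ bη`, `K₂η ≤ b` (they make the composite slots `≤ 7bη, 6bη, 5bη`), multiplier relative jets
`a_k ≤ η^k R_k(x)`; then the left side is `≤ η³·(C₀ + C₁x + C₂x² + C₃x³)` with the displayed coefficients, hence `≤ (4c/Λ)(2η/(π(ρ/x)))³` under the four
thresholds `4C_iρ³ ≤ (32c/(π³Λ))·x^{3-i}`. [cite: BenfattoGiulianiMastropietro2006, §3 (3.2)–(3.8)] -/
theorem famIncr_rate_three_le {c Λ B₁ B₂ B₃ k₁ k₂ k₃ K₂ K₃ t b b₂ b₂' b₃ b₃' a₁ a₂ a₃ η x ρ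
    r₁₀ r₁₁ r₂₀ r₂₁ r₂₂ r₃₀ r₃₁ r₃₂ r₃₃ C₀ C₁ C₂ C₃ K : ℝ}
    (hc : 0 ≤ c) (hΛ : 0 < Λ)
    (hk₁ : k₁ = (16 * B₁ + 16) / Λ ^ 2) (hk₂ : k₂ = (32 * B₂ + 144 * B₁ + 128) / Λ ^ 3) (hk₃ : k₃ = (64 * B₃ + 480 * B₂ + 1728 * B₁ + 1536) / Λ ^ 4)
    (hk₁0 : 0 ≤ k₁) (hk₂0 : 0 ≤ k₂) (hk₃0 : 0 ≤ k₃)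
    (hη : 0 ≤ η) (hx : 1 ≤ x) (hρ : 0 < ρ) (hb : 0 ≤ b)
    (ht0 : 0 ≤ t) (hK₂ : 0 ≤ K₂) (hK₂x : K₂ ≤ b₂ + b₂' * x) (hK₃x : K₃ ≤ b₃ + b₃' * x)
    (htb : t ≤ b * η) (hK₂η : K₂ * η ≤ b)
    (hr : 0 ≤ r₁₀ ∧ 0 ≤ r₁₁ ∧ 0 ≤ r₂₀ ∧ 0 ≤ r₂₁ ∧ 0 ≤ r₂₂ ∧ 0 ≤ r₃₀ ∧ 0 ≤ r₃₁ ∧ 0 ≤ r₃₂ ∧ 0 ≤ r₃₃)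
    (ha₁ : a₁ ≤ η * (r₁₀ + r₁₁ * x)) (ha₂ : a₂ ≤ η ^ 2 * (r₂₀ + r₂₁ * x + r₂₂ * x ^ 2)) (ha₃ : a₃ ≤ η ^ 3 * (r₃₀ + r₃₁ * x + r₃₂ * x ^ 2 + r₃₃ * x ^ 3))
    -- the cubic's coefficients
    (hC₀ : C₀ = 343 * k₃ * c * b ^ 3 + 21 * k₂ * c * b * b₂ + k₁ * c * b₃ + 3 * r₁₀ * (36 * k₂ * c * b ^ 2 + k₁ * c * b₂) +
      15 * r₂₀ * k₁ * c * b + r₃₀ * (4 * c / Λ))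
    (hC₁ : C₁ = 21 * k₂ * c * b * b₂' + k₁ * c * b₃' + 3 * r₁₁ * (36 * k₂ * c * b ^ 2 + k₁ * c * b₂) + 3 * r₁₀ * (k₁ * c * b₂') +
      15 * r₂₁ * k₁ * c * b + r₃₁ * (4 * c / Λ))
    (hC₂ : C₂ = 3 * r₁₁ * (k₁ * c * b₂') + 15 * r₂₂ * k₁ * c * b + r₃₂ * (4 * c / Λ))
    (hC₃ : C₃ = r₃₃ * (4 * c / Λ))
    (hK : K = 32 * c / (π ^ 3 * Λ))
    (th₃ : 4 * C₃ * ρ ^ 3 ≤ K) (th₂ : 4 * C₂ * ρ ^ 3 ≤ K * x) (th₁ : 4 * C₁ * ρ ^ 3 ≤ K * x ^ 2) (th₀ : 4 * C₀ * ρ ^ 3 ≤ K * x ^ 3) :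
    1 * ((64 * B₃ + 480 * B₂ + 1728 * B₁ + 1536) * c / Λ ^ 4 * (t + 6 * (K₂ * η ^ 2)) ^ 3 +
          3 * ((32 * B₂ + 144 * B₁ + 128) * c / Λ ^ 3 * (t + 6 * (K₂ * η ^ 2)) * (K₂ * η ^ 2)) +
          (16 * B₁ + 16) * c / Λ ^ 2 * (K₃ * η ^ 3)) +
        3 * (a₁ * ((32 * B₂ + 144 * B₁ + 128) * c / Λ ^ 3 * (t + 5 * (K₂ * η ^ 2)) ^ 2 + (16 * B₁ + 16) * c / Λ ^ 2 * (K₂ * η ^ 2))) +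
        3 * (a₂ * ((16 * B₁ + 16) * c / Λ ^ 2 * (t + 4 * (K₂ * η ^ 2)))) + a₃ * (4 * c / Λ) ≤
      4 * c / Λ * (2 * η / (π * (ρ / x))) ^ 3 := by
  obtain ⟨h10, h11, h20, h21, h22, h30, h31, h32, h33⟩ := hr
  have hx0 : 0 < x := lt_of_lt_of_le one_pos hx
  have hπ : 0 < π := Real.pi_pos
  have e₁ : (16 * B₁ + 16) * c / Λ ^ 2 = k₁ * c := by rw [hk₁]; ring
  have e₂ : (32 * B₂ + 144 * B₁ + 128) * c / Λ ^ 3 = k₂ * c := by rw [hk₂]; ring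
  have e₃ : (64 * B₃ + 480 * B₂ + 1728 * B₁ + 1536) * c / Λ ^ 4 = k₃ * c := by rw [hk₃]; ring
  rw [e₁, e₂, e₃]
  have hkc₁ : 0 ≤ k₁ * c := mul_nonneg hk₁0 hc
  have hkc₂ : 0 ≤ k₂ * c := mul_nonneg hk₂0 hc
  have hkc₃ : 0 ≤ k₃ * c := mul_nonneg hk₃0 hc
  have hB0 : 0 ≤ 4 * c / Λ := by positivity
  -- the composite slots in units of `bη`, the standalone band jets in units of `x`
  have hQ0 : 0 ≤ K₂ * η ^ 2 := by positivity
  have hQη : K₂ * η ^ 2 ≤ b * η := by nlinarith [mul_le_mul_of_nonneg_right hK₂η hη]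
  have hQx : K₂ * η ^ 2 ≤ (b₂ + b₂' * x) * η ^ 2 := mul_le_mul_of_nonneg_right hK₂x (pow_nonneg hη 2)
  have hK₃x' : K₃ * η ^ 3 ≤ (b₃ + b₃' * x) * η ^ 3 := mul_le_mul_of_nonneg_right hK₃x (pow_nonneg hη 3)
  have s6 : t + 6 * (K₂ * η ^ 2) ≤ 7 * b * η := by linarith
  have s5 : t + 5 * (K₂ * η ^ 2) ≤ 6 * b * η := by linarith
  have s4 : t + 4 * (K₂ * η ^ 2) ≤ 5 * b * η := by linarith
  have s60 : 0 ≤ t + 6 * (K₂ * η ^ 2) := by positivity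
  have s50 : 0 ≤ t + 5 * (K₂ * η ^ 2) := by positivity
  -- term by term
  have t0a : k₃ * c * (t + 6 * (K₂ * η ^ 2)) ^ 3 ≤ k₃ * c * (7 * b * η) ^ 3 :=
    mul_le_mul_of_nonneg_left (pow_le_pow_left₀ s60 s6 3) hkc₃
  have t0b : k₂ * c * (t + 6 * (K₂ * η ^ 2)) * (K₂ * η ^ 2) ≤ k₂ * c * (7 * b * η) * ((b₂ + b₂' * x) * η ^ 2) :=
    mul_le_mul (mul_le_mul_of_nonneg_left s6 hkc₂) hQx hQ0 (by positivity)
  have t0c : k₁ * c * (K₃ * η ^ 3) ≤ k₁ * c * ((b₃ + b₃' * x) * η ^ 3) := mul_le_mul_of_nonneg_left hK₃x' hkc₁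
  have hS₁ : k₂ * c * (t + 5 * (K₂ * η ^ 2)) ^ 2 + k₁ * c * (K₂ * η ^ 2) ≤ k₂ * c * (6 * b * η) ^ 2 + k₁ * c * ((b₂ + b₂' * x) * η ^ 2) :=
    add_le_add (mul_le_mul_of_nonneg_left (pow_le_pow_left₀ s50 s5 2) hkc₂) (mul_le_mul_of_nonneg_left hQx hkc₁)
  have hS₁0 : 0 ≤ k₂ * c * (t + 5 * (K₂ * η ^ 2)) ^ 2 + k₁ * c * (K₂ * η ^ 2) := by positivity
  have hS₂ : k₁ * c * (t + 4 * (K₂ * η ^ 2)) ≤ k₁ * c * (5 * b * η) := mul_le_mul_of_nonneg_left s4 hkc₁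
  have hS₂0 : 0 ≤ k₁ * c * (t + 4 * (K₂ * η ^ 2)) := by positivity
  have u1 : a₁ * (k₂ * c * (t + 5 * (K₂ * η ^ 2)) ^ 2 + k₁ * c * (K₂ * η ^ 2)) ≤
      (η * (r₁₀ + r₁₁ * x)) * (k₂ * c * (6 * b * η) ^ 2 + k₁ * c * ((b₂ + b₂' * x) * η ^ 2)) := mul_le_mul ha₁ hS₁ hS₁0 (by positivity)
  have u2 : a₂ * (k₁ * c * (t + 4 * (K₂ * η ^ 2))) ≤ (η ^ 2 * (r₂₀ + r₂₁ * x + r₂₂ * x ^ 2)) * (k₁ * c * (5 * b * η)) :=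
    mul_le_mul ha₂ hS₂ hS₂0 (by positivity)
  have u3 : a₃ * (4 * c / Λ) ≤ (η ^ 3 * (r₃₀ + r₃₁ * x + r₃₂ * x ^ 2 + r₃₃ * x ^ 3)) * (4 * c / Λ) := mul_le_mul_of_nonneg_right ha₃ hB0
  have hcub := cubic_le_of_thresholds hx hρ th₃ th₂ th₁ th₀
  calc 1 * (k₃ * c * (t + 6 * (K₂ * η ^ 2)) ^ 3 + 3 * (k₂ * c * (t + 6 * (K₂ * η ^ 2)) * (K₂ * η ^ 2)) + k₁ * c * (K₃ * η ^ 3)) +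
        3 * (a₁ * (k₂ * c * (t + 5 * (K₂ * η ^ 2)) ^ 2 + k₁ * c * (K₂ * η ^ 2))) +
        3 * (a₂ * (k₁ * c * (t + 4 * (K₂ * η ^ 2)))) + a₃ * (4 * c / Λ)
      ≤ 1 * (k₃ * c * (7 * b * η) ^ 3 + 3 * (k₂ * c * (7 * b * η) * ((b₂ + b₂' * x) * η ^ 2)) + k₁ * c * ((b₃ + b₃' * x) * η ^ 3)) +
        3 * ((η * (r₁₀ + r₁₁ * x)) * (k₂ * c * (6 * b * η) ^ 2 + k₁ * c * ((b₂ + b₂' * x) * η ^ 2))) +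
        3 * ((η ^ 2 * (r₂₀ + r₂₁ * x + r₂₂ * x ^ 2)) * (k₁ * c * (5 * b * η))) +
        (η ^ 3 * (r₃₀ + r₃₁ * x + r₃₂ * x ^ 2 + r₃₃ * x ^ 3)) * (4 * c / Λ) := by linarith [t0a, t0b, t0c, u1, u2, u3]
    _ = η ^ 3 * (C₀ + C₁ * x + C₂ * x ^ 2 + C₃ * x ^ 3) := by rw [hC₀, hC₁, hC₂, hC₃]; ring
    _ ≤ η ^ 3 * (K * x ^ 3 / ρ ^ 3) := mul_le_mul_of_nonneg_left hcub (pow_nonneg hη 3)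
    _ = 4 * c / Λ * (2 * η / (π * (ρ / x))) ^ 3 := by rw [hK]; field_simp; ring

/-! ### §3 Order two along the sector and the time inequality -/

set_option maxHeartbeats 400000 in
/-- **Order-two (anisotropic) rate inequality along the sector**: first slot `τ` (the tangency datum, `τ ≤ bη`), `K₂η ≤ b`, `K₂ ≤ b₂ + b₂′x`, rate `ρ₃/x`,
relative jets `a₁ ≤ η(r₁₀ + r₁₁x)`, `a₂ ≤ η²(r₂₀ + r₂₁x + r₂₂x²)`; the left side is `≤ η²(C₀ + C₁x + C₂x²)`, hence `≤ (4c/Λ)(2η/(π(ρ₃/x)))²` under the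
thresholds `3C_iρ₃² ≤ (16c/(π²Λ))·x^{2-i}`. [cite: BenfattoGiulianiMastropietro2006, §3 (3.2)–(3.8)] -/
theorem famIncr_rate_two_le {c Λ B₁ B₂ k₁ k₂ K₂ τ b b₂ b₂' a₁ a₂ η x ρ₃ r₁₀ r₁₁ r₂₀ r₂₁ r₂₂ C₀ C₁ C₂ K : ℝ}
    (hc : 0 ≤ c) (hΛ : 0 < Λ)
    (hk₁ : k₁ = (16 * B₁ + 16) / Λ ^ 2) (hk₂ : k₂ = (32 * B₂ + 144 * B₁ + 128) / Λ ^ 3) (hk₁0 : 0 ≤ k₁) (hk₂0 : 0 ≤ k₂)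
    (hη : 0 ≤ η) (hx : 1 ≤ x) (hρ : 0 < ρ₃) (hτ0 : 0 ≤ τ) (hK₂ : 0 ≤ K₂)
    (hK₂x : K₂ ≤ b₂ + b₂' * x) (hτb : τ ≤ b * η) (hK₂η : K₂ * η ≤ b)
    (hr : 0 ≤ r₁₀ ∧ 0 ≤ r₁₁ ∧ 0 ≤ r₂₀ ∧ 0 ≤ r₂₁ ∧ 0 ≤ r₂₂)
    (ha₁ : a₁ ≤ η * (r₁₀ + r₁₁ * x)) (ha₂ : a₂ ≤ η ^ 2 * (r₂₀ + r₂₁ * x + r₂₂ * x ^ 2))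
    (hC₀ : C₀ = 25 * k₂ * c * b ^ 2 + k₁ * c * b₂ + 8 * r₁₀ * k₁ * c * b + r₂₀ * (4 * c / Λ))
    (hC₁ : C₁ = k₁ * c * b₂' + 8 * r₁₁ * k₁ * c * b + r₂₁ * (4 * c / Λ)) (hC₂ : C₂ = r₂₂ * (4 * c / Λ))
    (hK : K = 16 * c / (π ^ 2 * Λ))
    (th₂ : 3 * C₂ * ρ₃ ^ 2 ≤ K) (th₁ : 3 * C₁ * ρ₃ ^ 2 ≤ K * x) (th₀ : 3 * C₀ * ρ₃ ^ 2 ≤ K * x ^ 2) :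
    1 * ((32 * B₂ + 144 * B₁ + 128) * c / Λ ^ 3 * (τ + 4 * (K₂ * η ^ 2)) ^ 2 + (16 * B₁ + 16) * c / Λ ^ 2 * (K₂ * η ^ 2)) +
        2 * (a₁ * ((16 * B₁ + 16) * c / Λ ^ 2 * (τ + 3 * (K₂ * η ^ 2)))) + a₂ * (4 * c / Λ) ≤
      4 * c / Λ * (2 * η / (π * (ρ₃ / x))) ^ 2 := by
  obtain ⟨h10, h11, h20, h21, h22⟩ := hr
  have hx0 : 0 < x := lt_of_lt_of_le one_pos hx
  have hπ : 0 < π := Real.pi_pos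
  have e₁ : (16 * B₁ + 16) * c / Λ ^ 2 = k₁ * c := by rw [hk₁]; ring
  have e₂ : (32 * B₂ + 144 * B₁ + 128) * c / Λ ^ 3 = k₂ * c := by rw [hk₂]; ring
  rw [e₁, e₂]
  have hkc₁ : 0 ≤ k₁ * c := mul_nonneg hk₁0 hc
  have hkc₂ : 0 ≤ k₂ * c := mul_nonneg hk₂0 hc
  have hB0 : 0 ≤ 4 * c / Λ := by positivity
  have hQx : K₂ * η ^ 2 ≤ (b₂ + b₂' * x) * η ^ 2 := mul_le_mul_of_nonneg_right hK₂x (pow_nonneg hη 2)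
  have hQη : K₂ * η ^ 2 ≤ b * η := by nlinarith [mul_le_mul_of_nonneg_right hK₂η hη]
  have s4 : τ + 4 * (K₂ * η ^ 2) ≤ 5 * b * η := by linarith
  have s3 : τ + 3 * (K₂ * η ^ 2) ≤ 4 * b * η := by linarith
  have s40 : 0 ≤ τ + 4 * (K₂ * η ^ 2) := by positivity
  have t0a : k₂ * c * (τ + 4 * (K₂ * η ^ 2)) ^ 2 ≤ k₂ * c * (5 * b * η) ^ 2 := mul_le_mul_of_nonneg_left (pow_le_pow_left₀ s40 s4 2) hkc₂
  have t0b : k₁ * c * (K₂ * η ^ 2) ≤ k₁ * c * ((b₂ + b₂' * x) * η ^ 2) := mul_le_mul_of_nonneg_left hQx hkc₁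
  have hS : k₁ * c * (τ + 3 * (K₂ * η ^ 2)) ≤ k₁ * c * (4 * b * η) := mul_le_mul_of_nonneg_left s3 hkc₁
  have hS0 : 0 ≤ k₁ * c * (τ + 3 * (K₂ * η ^ 2)) := by positivity
  have u1 : a₁ * (k₁ * c * (τ + 3 * (K₂ * η ^ 2))) ≤ (η * (r₁₀ + r₁₁ * x)) * (k₁ * c * (4 * b * η)) := mul_le_mul ha₁ hS hS0 (by positivity)
  have u2 : a₂ * (4 * c / Λ) ≤ (η ^ 2 * (r₂₀ + r₂₁ * x + r₂₂ * x ^ 2)) * (4 * c / Λ) := mul_le_mul_of_nonneg_right ha₂ hB0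
  have hquad := quadratic_le_of_thresholds hx hρ th₂ th₁ th₀
  calc 1 * (k₂ * c * (τ + 4 * (K₂ * η ^ 2)) ^ 2 + k₁ * c * (K₂ * η ^ 2)) + 2 * (a₁ * (k₁ * c * (τ + 3 * (K₂ * η ^ 2)))) + a₂ * (4 * c / Λ)
      ≤ 1 * (k₂ * c * (5 * b * η) ^ 2 + k₁ * c * ((b₂ + b₂' * x) * η ^ 2)) + 2 * ((η * (r₁₀ + r₁₁ * x)) * (k₁ * c * (4 * b * η))) +
        (η ^ 2 * (r₂₀ + r₂₁ * x + r₂₂ * x ^ 2)) * (4 * c / Λ) := by linarith [t0a, t0b, u1, u2]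
    _ = η ^ 2 * (C₀ + C₁ * x + C₂ * x ^ 2) := by rw [hC₀, hC₁, hC₂]; ring
    _ ≤ η ^ 2 * (K * x ^ 2 / ρ₃ ^ 2) := mul_le_mul_of_nonneg_left hquad (pow_nonneg hη 2)
    _ = 4 * c / Λ * (2 * η / (π * (ρ₃ / x))) ^ 2 := by rw [hK]; field_simp; ring

/-- **Time rate inequality** of the family-increment pair (x-free: a level condition): with the increment's relative time jets `at_k ≤ θ_k` (constants) and the
level condition `h` on the `θ`'s, the Leibniz left side is `≤ (4c/Λ)(4/(s₀P))³`. [cite: BenfattoGiulianiMastropietro2006, §3 (3.2)] -/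
theorem famIncr_rate_time_le {c Λ B₁ B₂ B₃ at₁ at₂ at₃ θ₁ θ₂ θ₃ hβ s₀ P : ℝ} (hc : 0 ≤ c) (hΛ : 0 < Λ)
    (hB₁ : 0 ≤ B₁) (hB₂ : 0 ≤ B₂) (hhβ : 0 ≤ hβ) (ha₁ : at₁ ≤ θ₁) (ha₂ : at₂ ≤ θ₂) (ha₃ : at₃ ≤ θ₃)
    (h : hβ ^ 3 * ((64 * B₃ + 480 * B₂ + 1728 * B₁ + 1536) * c / Λ ^ 4) + 3 * (θ₁ * (hβ ^ 2 * ((32 * B₂ + 144 * B₁ + 128) * c / Λ ^ 3))) +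
        3 * (θ₂ * (hβ * ((16 * B₁ + 16) * c / Λ ^ 2))) + θ₃ * (4 * c / Λ) ≤ 4 * c / Λ * (4 / (s₀ * P)) ^ 3) :
    1 * (hβ ^ 3 * ((64 * B₃ + 480 * B₂ + 1728 * B₁ + 1536) * c / Λ ^ 4)) + 3 * (at₁ * (hβ ^ 2 * ((32 * B₂ + 144 * B₁ + 128) * c / Λ ^ 3))) +
        3 * (at₂ * (hβ * ((16 * B₁ + 16) * c / Λ ^ 2))) + at₃ * (4 * c / Λ) ≤ 4 * c / Λ * (4 / (s₀ * P)) ^ 3 := by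
  have p3 : 0 ≤ hβ ^ 2 * ((32 * B₂ + 144 * B₁ + 128) * c / Λ ^ 3) := by positivity
  have p2 : 0 ≤ hβ * ((16 * B₁ + 16) * c / Λ ^ 2) := by positivity
  have p1 : 0 ≤ 4 * c / Λ := by positivity
  nlinarith [mul_le_mul_of_nonneg_right ha₁ p3, mul_le_mul_of_nonneg_right ha₂ p2, mul_le_mul_of_nonneg_right ha₃ p1, h]

end Summit.HubbardSuperconductivity.HubbardSuperconductivity.Theorems.TorusFourierL2

end
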